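/-
Copyright (c) 2026 the pub-hodgecm-mathlib formalisation cell (harness21).  Prover seat hodgecm-mathlib-K2E1-p15 (g3), Track B ∕ K2-LIT, h413 = `stmt-HodgeConjecture-24833`,
R90-TF section S8 «ContSpec-n½», #4′ road, MODEL-FAMILY brick (α) — companion module «brick representatives invisible» (S8-R128 (5): new module, ★ p863051 untouched):
the self-dual M1 isometry on `resHBlock L μ K_max 1 χ` with the brick representatives CHOSEN inside (every brick `[θ_{f,φ₀}]`, `f ∈ C²_c((0,∞))`, is square-integrable).
-/
import Summits.HodgeConjecture.HodgeConjecture.Theorems.R90S8ResHBlockSelfDualModelM1U2   -- ★ p863051 (this seat): `exists_selfDual_isometry_resHBlock_m1` (representatives `y, hy` visible)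
import Summits.HodgeConjecture.HodgeConjecture.Theorems.K2E1EisensteinNiceClassCMTwo       -- ★ F3d-δ (K2E1-p15 lineage): `memLp_quotFun_eisensteinSeriesU_of_nice`
import Summits.HodgeConjecture.HodgeConjecture.Theorems.K2E1PseudoEisensteinSmoothBricksDenseU2 -- ★ p860789: `exists_band_forall_smooth_approx` (the height band of a `C_c((0,∞))` profile)
import Summits.HodgeConjecture.HodgeConjecture.Theorems.K2E1ChiSectionBoundedOfUnitaryU2  -- ★ p860823: `exists_bound_of_isChiSection_of_isUnitary`
import HarnessLib

/-!
# S8 #4′ road — `R90S8ResHBlockSelfDualModelM1RepsU2`: the bricks `[θ_{f,φ}]` are square-integrable, and the self-dual M1 isometry on `resHBlock L μ K_max 1 χ` with CHOSEN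
# representatives (MODEL-FAMILY (α), companion of ★ p863051)

Track B ∕ K2-LIT, crux h413 = `stmt-HodgeConjecture-24833`, route of record `HCCMUnconditional`; cell `hodgecm-mathlib`, R90-TF programme, section S8 «ContSpec-n½», socket #4′
`sock_S8_resH_spannedByCharLines` (B ED. 4 :256).  THEOREMS ONLY (no `def`, no `instance`, no `notation`, no named-fact hypothesis, no `sorry`; default heartbeats); lane
`--supports stmt-HodgeConjecture-24833 --as helper` (count-neutral).  CLOSES NO SOCKET.  ★ p863051 `exists_selfDual_isometry_resHBlock_m1` takes the `L²` representatives `y_f` of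
the bricks `θ_{f,φ₀}` (`f ∈ C²_c((0,∞))`) as VISIBLE binders `(y, hy)`; here they are CHOSEN: §1 proves that every brick `θ_{f,φ}` (`f ∈ C_c((0,∞))`, `φ` a continuous section of a
UNITARY `χ`, any level datum) has `quotFun θ_{f,φ} ∈ L²(𝔛, μ)` — the nice class of ★ `memLp_quotFun_eisensteinSeriesU_of_nice` (continuity ★ `continuous_borelHeight`; `B(L⁺)`-invariance
★ `borelHeight_arithmeticBorel_mul` + ★ `IsChiSection.arithmeticBorel_mul`; sup bound = `‖f‖_∞ ·` ★ `exists_bound_of_isChiSection_of_isUnitary`; height band ★ `exists_band_forall_smooth_approx`)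
— and §2 re-exports ★ p863051 with `y_f := [quotFun θ_{f,φ₀}]`.
* §1 **`memLp_quotFun_brick`** — `MemLp (quotFun (E (f∘H · φ))) p μ` for every exponent `p`, `χ` unitary, `φ` a continuous `χ`-section, `f ∈ C_c((0,∞))`.
* §2 **`exists_selfDual_isometry_resHBlock_m1'`** — ★ p863051 §2 with the representatives chosen: binders = RUNG-1 structural data + normalised `φ₀` + its `L²(K_max)` representative `v` + `σ₀`;
  conclusion = ★ M1's package clauses ∧ `∀ f (hv) (hi), Uiso ⟨hv.toLp, hi⟩ = toLp (r′_f, √(C∕2π)•w_f)` ∧ the bricks' `MemLp` and block membership.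
HONEST LABEL: HC_CM is proved only modulo the 7 printed citations (2 remaining named inputs: hLiu418 = `stmt-HodgeConjecture-24832`, h413 = `stmt-HodgeConjecture-24833`) until
rung 0 closes; REL ≠ ★ ≠ BUILT; this file asserts no named fact, instantiates ONE level family, and closes no socket; count-neutral.

## References
* [MoeglinWaldspurger1995] C. Mœglin, J.-L. Waldspurger, *Spectral Decomposition and Eisenstein Series* (1995), I.2.2, I.2.13, II.1.3, II.1.7, IV.1.10.
* [Langlands1976] R. P. Langlands, *On the Functional Equations Satisfied by Eisenstein Series*, LNM 544 (1976), §7.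
-/

set_option autoImplicit false
set_option linter.dupNamespace false  -- the mandated namespace `…HodgeConjecture.HodgeConjecture.R90.S8` (LEAD #1 L1) repeats the summit's segment

noncomputable section

open MeasureTheory MeasureTheory.Measure Set NumberField IsDedekindDomain Filter Topology Complex
open scoped Real NNReal ENNReal ComplexConjugate InnerProductSpace BigOperators
open Literature.MeasureTheory.Group Literature.NumberTheory
open Literature.NumberTheory.Automorphic Literature.NumberTheory.Automorphic.UnitaryGroup AdelicGroupData
open Literature.NumberTheory.GaloisRepresentations
open Summit.HodgeConjecture.HodgeConjecture.Cruxes.H413.K2E1BorelEisensteinU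
open Summit.HodgeConjecture.HodgeConjecture.Cruxes.H413.K2E1BLBorelSpacesU2Defs
open Summit.HodgeConjecture.HodgeConjecture.Cruxes.H413.K2E1BLBorelOperatorsU2Defs
open Summit.HodgeConjecture.HodgeConjecture.Cruxes.H413.K2E1CharacterEisensteinU2Defs
open Summit.HodgeConjecture.HodgeConjecture.Cruxes.H413.K2E1ChiSectionSpaceU2Defs
open Summit.HodgeConjecture.HodgeConjecture.Cruxes.H413.K2E1EisensteinNiceClassCMTwo (memLp_quotFun_eisensteinSeriesU_of_nice)
open Summit.HodgeConjecture.HodgeConjecture.Cruxes.H413.K2E1PseudoEisensteinSmoothBricksDenseU2 (exists_band_forall_smooth_approx)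
open Summit.HodgeConjecture.HodgeConjecture.Cruxes.H413.K2E1ChiSectionBoundedOfUnitaryU2 (exists_bound_of_isChiSection_of_isUnitary)
open Summit.HodgeConjecture.HodgeConjecture.Cruxes.H413.K2E1PlancherelIsometryOfForm (mem_topologicalClosure_span)

namespace Summit.HodgeConjecture.HodgeConjecture.R90.S8

variable (L : Type) [Field L] [NumberField L] [IsCMField L]
  [MeasurableSpace (quasiSplit (↥(maximalRealSubfield L)) L (IsCMField.complexConj L) 2).Adelic] [BorelSpace (quasiSplit (↥(maximalRealSubfield L)) L (IsCMField.complexConj L) 2).Adelic]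
  [MeasurableSpace (AdeleRing (𝓞 L) L)ˣ] [BorelSpace (AdeleRing (𝓞 L) L)ˣ]
  (μ : Measure (quasiSplit (↥(maximalRealSubfield L)) L (IsCMField.complexConj L) 2).automorphicQuotient) [(quasiSplit (↥(maximalRealSubfield L)) L (IsCMField.complexConj L) 2).IsAutomorphicMeasure μ]

/-! ## §1 Bricks are square-integrable -/

omit [MeasurableSpace (AdeleRing (𝓞 L) L)ˣ] [BorelSpace (AdeleRing (𝓞 L) L)ˣ] in
/-- **`quotFun θ_{f,φ} ∈ L^p(𝔛, μ)`** for `f ∈ C_c((0,∞))`, `φ` a continuous section of a UNITARY `χ` (`IsChiSection χ φ`), every exponent `p` and every finite (here: automorphic) measure: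
the Borel-side function `u = (f∘H)·φ` is in the nice class of ★ `memLp_quotFun_eisensteinSeriesU_of_nice` — continuous (★ `continuous_borelHeight`), left `B(L⁺)`-invariant (★
`borelHeight_arithmeticBorel_mul`, ★ `IsChiSection.arithmeticBorel_mul`), bounded (`‖f‖_∞·‖φ‖_∞`, ★ `exists_bound_of_isChiSection_of_isUnitary`), supported in a height band `[a, b]`,
`a > 0` (★ `exists_band_forall_smooth_approx`). [cite: MoeglinWaldspurger1995, I.2.13, II.1.3] -/
theorem memLp_quotFun_brick (p : ℝ≥0∞) {χ : HeckeCharacter L} (hχu : χ.IsUnitary)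
    {f : ℝ → ℂ} (hf : Continuous f) (hfs : HasCompactSupport f) (hf0 : tsupport f ⊆ Ioi 0)
    {φ : (quasiSplit (↥(maximalRealSubfield L)) L (IsCMField.complexConj L) 2).Adelic → ℂ} (hφ : IsChiSection χ φ) (hφc : Continuous φ) :
    MemLp ((quasiSplit (↥(maximalRealSubfield L)) L (IsCMField.complexConj L) 2).quotFun (eisensteinSeriesU (fun g : (quasiSplit (↥(maximalRealSubfield L)) L (IsCMField.complexConj L) 2).Adelic => f (borelHeight g : ℝ) * φ g))) p μ := by
  obtain ⟨Mφ, hMφ⟩ := exists_bound_of_isChiSection_of_isUnitary L 2 hχu hφ hφc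
  obtain ⟨a, b, ha, hfa, -⟩ := exists_band_forall_smooth_approx hf hfs hf0
  obtain ⟨Mf, hMf⟩ := hf.bounded_above_of_compact_support hfs
  -- the nice class of `u = (f∘H)·φ`
  have huc : Continuous fun g : (quasiSplit (↥(maximalRealSubfield L)) L (IsCMField.complexConj L) 2).Adelic => f (borelHeight g : ℝ) * φ g :=
    (hf.comp (NNReal.continuous_coe.comp continuous_borelHeight)).mul hφc
  have huB : ∀ β ∈ arithmeticBorel (↥(maximalRealSubfield L)) L (IsCMField.complexConj L) 2, ∀ x : (quasiSplit (↥(maximalRealSubfield L)) L (IsCMField.complexConj L) 2).Adelic,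
      f (borelHeight ((β : (quasiSplit (↥(maximalRealSubfield L)) L (IsCMField.complexConj L) 2).Adelic) * x) : ℝ) * φ ((β : (quasiSplit (↥(maximalRealSubfield L)) L (IsCMField.complexConj L) 2).Adelic) * x) = f (borelHeight x : ℝ) * φ x := fun β hβ x => by
    rw [Summit.HodgeConjecture.HodgeConjecture.Cruxes.H413.K2E1TruncatedEisensteinExplicit.borelHeight_arithmeticBorel_mul hβ x, hφ.arithmeticBorel_mul β hβ x]
  have huM : ∀ g : (quasiSplit (↥(maximalRealSubfield L)) L (IsCMField.complexConj L) 2).Adelic, ‖f (borelHeight g : ℝ) * φ g‖ ≤ Mf * Mφ := fun g => by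
    rw [norm_mul]
    exact mul_le_mul (hMf _) (hMφ g) (norm_nonneg _) ((norm_nonneg _).trans (hMf 1))
  have ha' : 0 < a.toNNReal := Real.toNNReal_pos.2 ha
  have hband : ∀ g : (quasiSplit (↥(maximalRealSubfield L)) L (IsCMField.complexConj L) 2).Adelic, f (borelHeight g : ℝ) * φ g ≠ 0 → a.toNNReal ≤ borelHeight g ∧ borelHeight g ≤ (max b 0).toNNReal := by
    intro g hg
    have hfg : f (borelHeight g : ℝ) ≠ 0 := fun h0 => hg (by rw [h0, zero_mul])
    obtain ⟨h1, h2⟩ := hfa _ hfg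
    refine ⟨?_, ?_⟩
    · rw [← NNReal.coe_le_coe, Real.coe_toNNReal _ ha.le]; exact h1
    · rw [← NNReal.coe_le_coe, Real.coe_toNNReal _ (le_max_right _ _)]; exact h2.trans (le_max_left _ _)
  exact memLp_quotFun_eisensteinSeriesU_of_nice L μ p huc huB huM ha' hband

/-! ## §2 The self-dual M1 isometry on the block with chosen representatives -/

/-- **THE SELF-DUAL BLOCK AT `K_max` IS LEFT-MODELLED, representatives CHOSEN** (★ p863051 `exists_selfDual_isometry_resHBlock_m1` at `y_f := [quotFun θ_{f,φ₀}]`, §1): binders = the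
RUNG-1 structural data, the normalised section `φ₀` with its `L²(K_max)` representative `v`, and `σ₀ > 1` — NO brick representatives.  Conclusion: ★ M1's package clauses verbatim,
the bricks' square-integrability and block membership, and `Uiso ⟨[θ_{f,φ₀}], _⟩ = toLp (r′_f, √(C∕2π)•w_f)` for every `f ∈ C²_c((0,∞))` (any `MemLp` witness, any membership proof).
[cite: MoeglinWaldspurger1995, II.1.7, IV.1.10, IV.3.12] [cite: Langlands1976, §7] -/
theorem exists_selfDual_isometry_resHBlock_m1'
    (νG : Measure (quasiSplit (↥(maximalRealSubfield L)) L (IsCMField.complexConj L) 2).Adelic) [νG.IsHaarMeasure] [νG.IsInvInvariant] [SFinite νG]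
    (μK : Measure ↥((standardMaximalCompactGL 2 L).comap (adelicVal (↥(maximalRealSubfield L)) L (IsCMField.complexConj L) 2 ((StdForm.antidiagonal 2).over L)) : Subgroup (quasiSplit (↥(maximalRealSubfield L)) L (IsCMField.complexConj L) 2).Adelic)) [μK.IsHaarMeasure]
    (νI : Measure (AdeleRing (𝓞 L) L)ˣ) [νI.IsHaarMeasure]
    {𝓕I : Set (AdeleRing (𝓞 L) L)ˣ} (h𝓕I : IsIdeleClassDomain L 𝓕I)
    (ν : Measure ↥(adelicUnipotent (↥(maximalRealSubfield L)) L (IsCMField.complexConj L) 2)) [ν.IsHaarMeasure] [ν.IsMulRightInvariant] [ν.IsInvInvariant]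
    {𝓕 : Set ↥(adelicUnipotent (↥(maximalRealSubfield L)) L (IsCMField.complexConj L) 2)} (h𝓕N : IsFundamentalDomain ↥(rationalUnipotent (↥(maximalRealSubfield L)) L (IsCMField.complexConj L) 2) 𝓕 ν) (h𝓕1 : ν 𝓕 = 1)
    (h𝓕c : IsCompact (closure 𝓕))
    {β : (quasiSplit (↥(maximalRealSubfield L)) L (IsCMField.complexConj L) 2).Adelic → ℝ≥0∞} (hβ : IsCoveringWeight ↥((arithmeticBorel (↥(maximalRealSubfield L)) L (IsCMField.complexConj L) 2).map (quasiSplit (↥(maximalRealSubfield L)) L (IsCMField.complexConj L) 2).arithmeticSubgroup.subtype) β)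
    {μZ : Measure (borelQuotient (↥(maximalRealSubfield L)) L (IsCMField.complexConj L) 2)} [SFinite μZ]
    (hμZ : ∀ f : borelQuotient (↥(maximalRealSubfield L)) L (IsCMField.complexConj L) 2 → ℝ≥0∞, Measurable f → ∫⁻ z, f z ∂μZ = ∫⁻ g, β g * f (toBorelQuotient (↥(maximalRealSubfield L)) L (IsCMField.complexConj L) 2 g) ∂νG)
    {χ : HeckeCharacter L} (hχ : χ.IsUnitary) (hρ : ∀ r : ℝ≥0ˣ, χ (posRealIdele L r) = 1) (hsd : reflectChar (IsCMField.complexConj L) χ = χ)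
    {φ : (quasiSplit (↥(maximalRealSubfield L)) L (IsCMField.complexConj L) 2).Adelic → ℂ} (hφV : φ ∈ chiSectionSpace χ ((standardMaximalCompactGL 2 L).comap (adelicVal (↥(maximalRealSubfield L)) L (IsCMField.complexConj L) 2 ((StdForm.antidiagonal 2).over L)) : Subgroup (quasiSplit (↥(maximalRealSubfield L)) L (IsCMField.complexConj L) 2).Adelic) (fun _ => 1)) (hφc : Continuous φ) {Mφ : ℝ} (hφM : ∀ x, ‖φ x‖ ≤ Mφ)
    (hφinf : ∀ a : arch (↥(maximalRealSubfield L)) L (IsCMField.complexConj L) 2 ((StdForm.antidiagonal 2).over L), φ (archToAdelic (↥(maximalRealSubfield L)) L (IsCMField.complexConj L) 2 _ a) = φ 1)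
    (hφ1 : φ 1 ≠ 0) (hφ1r : conj (φ 1) = φ 1)
    (v : Lp ℂ 2 μK) (hv : ((v : Lp ℂ 2 μK) : ↥((standardMaximalCompactGL 2 L).comap (adelicVal (↥(maximalRealSubfield L)) L (IsCMField.complexConj L) 2 ((StdForm.antidiagonal 2).over L)) : Subgroup (quasiSplit (↥(maximalRealSubfield L)) L (IsCMField.complexConj L) 2).Adelic) → ℂ) =ᵐ[μK]
      fun k => φ (k : (quasiSplit (↥(maximalRealSubfield L)) L (IsCMField.complexConj L) 2).Adelic))
    {σ₀ : ℝ} (hσ₀ : 1 < σ₀) :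
    ∃ (s : ℂ → ℂ) (P : Set ℂ) (C : ℝ) (S : Finset ℝ) (ρ : ℝ → ℂ)
      (r' : ↥{f : ℝ → ℂ | ContDiff ℝ 2 f ∧ HasCompactSupport f ∧ tsupport f ⊆ Ioi 0} → PiLp 2 (fun _ : ↥S => ↥(Submodule.span ℂ (Set.range fun _ : Unit => v))))
      (w : ↥{f : ℝ → ℂ | ContDiff ℝ 2 f ∧ HasCompactSupport f ∧ tsupport f ⊆ Ioi 0} → Lp ↥(Submodule.span ℂ (Set.range fun _ : Unit => v)) 2 ((volume : Measure ℝ).restrict (Ioi 0)))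
      (Uiso : ↥(resHBlock L μ ((standardMaximalCompactGL 2 L).comap (adelicVal (↥(maximalRealSubfield L)) L (IsCMField.complexConj L) 2 ((StdForm.antidiagonal 2).over L))) 1 χ) →ₗᵢ[ℂ]
        WithLp 2 (PiLp 2 (fun _ : ↥S => ↥(Submodule.span ℂ (Set.range fun _ : Unit => v))) × Lp ↥(Submodule.span ℂ (Set.range fun _ : Unit => v)) 2 ((volume : Measure ℝ).restrict (Ioi 0)))),
      (∀ z : ℂ, 1 < z.re → s z = (((ν 𝓕).toReal⁻¹ : ℝ) : ℂ) * ((φ 1)⁻¹ * ∫ u : ↥(adelicUnipotent (↥(maximalRealSubfield L)) L (IsCMField.complexConj L) 2), flatSectionU φ z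
        ((quasiSplit (↥(maximalRealSubfield L)) L (IsCMField.complexConj L) 2).toAdelic (weylLongU (IsCMField.complexConj L : L →+* L)
          (rfl : (StdForm.antidiagonal 2).over L = (StdForm.antidiagonal 2).over L)) * ((u : (quasiSplit (↥(maximalRealSubfield L)) L (IsCMField.complexConj L) 2).Adelic) * 1)) ∂ν)) ∧
      MeromorphicNFOn s univ ∧ IsClosed P ∧ (∀ z ∈ P, z.re ≤ 1) ∧ (∀ z : ℂ, z ∉ P → AnalyticAt ℂ s z) ∧
      0 < C ∧
      (∀ c ∈ S, ¬ AnalyticAt ℂ s (c : ℂ) ∧ 1 / 2 < c ∧ c < σ₀) ∧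
      (∀ c ∈ S, Tendsto (fun z : ℂ => (z - c) * s z) (𝓝[≠] (c : ℂ)) (𝓝 (ρ c)) ∧ (ρ c).im = 0 ∧ 0 ≤ (ρ c).re) ∧
      (∀ i j, ⟪r' i, r' j⟫_ℂ = (C : ℂ) * ∑ c ∈ S, ⟪∑ b, mellin ((fun (i : ↥{f : ℝ → ℂ | ContDiff ℝ 2 f ∧ HasCompactSupport f ∧ tsupport f ⊆ Ioi 0}) (_ : Unit) => (i : ℝ → ℂ)) i b) (-(c : ℂ)) • (⟨(fun _ : Unit => v) b, Submodule.subset_span ⟨b, rfl⟩⟩ : ↥(Submodule.span ℂ (Set.range fun _ : Unit => v))),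
        ρ c • ∑ a, mellin ((fun (i : ↥{f : ℝ → ℂ | ContDiff ℝ 2 f ∧ HasCompactSupport f ∧ tsupport f ⊆ Ioi 0}) (_ : Unit) => (i : ℝ → ℂ)) j a) (-(c : ℂ)) • (⟨(fun _ : Unit => v) a, Submodule.subset_span ⟨a, rfl⟩⟩ : ↥(Submodule.span ℂ (Set.range fun _ : Unit => v)))⟫_ℂ) ∧
      (∀ i, (w i : ℝ → ↥(Submodule.span ℂ (Set.range fun _ : Unit => v))) =ᵐ[(volume : Measure ℝ).restrict (Ioi 0)] fun t =>
        (∑ a, mellin ((fun (i : ↥{f : ℝ → ℂ | ContDiff ℝ 2 f ∧ HasCompactSupport f ∧ tsupport f ⊆ Ioi 0}) (_ : Unit) => (i : ℝ → ℂ)) i a) (-((((1 / 2 : ℝ)) : ℂ) + t * I)) • (⟨(fun _ : Unit => v) a, Submodule.subset_span ⟨a, rfl⟩⟩ : ↥(Submodule.span ℂ (Set.range fun _ : Unit => v)))) +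
          s ((((1 / 2 : ℝ)) : ℂ) + ((-t : ℝ) : ℂ) * I) •
            ∑ a, mellin ((fun (i : ↥{f : ℝ → ℂ | ContDiff ℝ 2 f ∧ HasCompactSupport f ∧ tsupport f ⊆ Ioi 0}) (_ : Unit) => (i : ℝ → ℂ)) i a) (-((((1 / 2 : ℝ)) : ℂ) + ((-t : ℝ) : ℂ) * I)) • (⟨(fun _ : Unit => v) a, Submodule.subset_span ⟨a, rfl⟩⟩ : ↥(Submodule.span ℂ (Set.range fun _ : Unit => v)))) ∧
      (∀ i : ↥{f : ℝ → ℂ | ContDiff ℝ 2 f ∧ HasCompactSupport f ∧ tsupport f ⊆ Ioi 0}, MemLp ((quasiSplit (↥(maximalRealSubfield L)) L (IsCMField.complexConj L) 2).quotFun (eisensteinSeriesU (fun g : (quasiSplit (↥(maximalRealSubfield L)) L (IsCMField.complexConj L) 2).Adelic => (i : ℝ → ℂ) (borelHeight g : ℝ) * ((1 : ℂ) • φ) g))) 2 μ) ∧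
      (∀ (i : ↥{f : ℝ → ℂ | ContDiff ℝ 2 f ∧ HasCompactSupport f ∧ tsupport f ⊆ Ioi 0}) (hv : MemLp ((quasiSplit (↥(maximalRealSubfield L)) L (IsCMField.complexConj L) 2).quotFun (eisensteinSeriesU (fun g : (quasiSplit (↥(maximalRealSubfield L)) L (IsCMField.complexConj L) 2).Adelic => (i : ℝ → ℂ) (borelHeight g : ℝ) * ((1 : ℂ) • φ) g))) 2 μ), hv.toLp _ ∈ resHBlock L μ ((standardMaximalCompactGL 2 L).comap (adelicVal (↥(maximalRealSubfield L)) L (IsCMField.complexConj L) 2 ((StdForm.antidiagonal 2).over L))) 1 χ) ∧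
      (∀ (i : ↥{f : ℝ → ℂ | ContDiff ℝ 2 f ∧ HasCompactSupport f ∧ tsupport f ⊆ Ioi 0}) (hv : MemLp ((quasiSplit (↥(maximalRealSubfield L)) L (IsCMField.complexConj L) 2).quotFun (eisensteinSeriesU (fun g : (quasiSplit (↥(maximalRealSubfield L)) L (IsCMField.complexConj L) 2).Adelic => (i : ℝ → ℂ) (borelHeight g : ℝ) * ((1 : ℂ) • φ) g))) 2 μ) (hi : hv.toLp _ ∈ resHBlock L μ ((standardMaximalCompactGL 2 L).comap (adelicVal (↥(maximalRealSubfield L)) L (IsCMField.complexConj L) 2 ((StdForm.antidiagonal 2).over L))) 1 χ),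
        Uiso ⟨hv.toLp _, hi⟩ = WithLp.toLp 2 (r' i, ((Real.sqrt (C * (2 * π)⁻¹) : ℝ) : ℂ) • w i)) := by
  -- §1: the representatives
  have hφ1V : ((1 : ℂ) • φ) ∈ chiSectionSpace χ ((standardMaximalCompactGL 2 L).comap (adelicVal (↥(maximalRealSubfield L)) L (IsCMField.complexConj L) 2 ((StdForm.antidiagonal 2).over L))) (fun _ => 1) := Submodule.smul_mem _ _ hφV
  have hmem : ∀ i : ↥{f : ℝ → ℂ | ContDiff ℝ 2 f ∧ HasCompactSupport f ∧ tsupport f ⊆ Ioi 0}, MemLp ((quasiSplit (↥(maximalRealSubfield L)) L (IsCMField.complexConj L) 2).quotFun (eisensteinSeriesU (fun g : (quasiSplit (↥(maximalRealSubfield L)) L (IsCMField.complexConj L) 2).Adelic => (i : ℝ → ℂ) (borelHeight g : ℝ) * ((1 : ℂ) • φ) g))) 2 μ := fun i =>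
    memLp_quotFun_brick L μ 2 hχ i.2.1.continuous i.2.2.1 i.2.2.2 hφ1V.1 (hφc.const_smul _)
  have H := exists_selfDual_isometry_resHBlock_m1 L μ νG μK νI h𝓕I ν h𝓕N h𝓕1 h𝓕c hβ hμZ hχ hρ hsd hφV hφc hφM hφinf hφ1 hφ1r v hv
    (fun i => (hmem i).toLp _) (fun i => (hmem i).coeFn_toLp) hσ₀
  obtain ⟨s, P, C, S, ρ, r', w, Uiso, h1, h2, h3, h4, h5, h6, h7, h8, h9, h10, hyB, hU⟩ := H
  refine ⟨s, P, C, S, ρ, r', w, Uiso, h1, h2, h3, h4, h5, h6, h7, h8, h9, h10, hmem, fun i _ => ?_, fun i _ hi => ?_⟩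
  · exact hyB i
  · exact hU i hi

end Summit.HodgeConjecture.HodgeConjecture.R90.S8

end
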